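import Literature.Computability.Cryptography.LWEHomomorphicImage
import Literature.Computability.Cryptography.LWERegevTransforms
import HarnessLib

/-!
# Ring automorphisms acting on Ring-LWE and Module-LWE samples; invariance of symmetric coefficient laws (LPR13 §5)

Topic `Computability/Cryptography` (LWE), grouping namespace `LWE` (the model of
`Literature/Computability/Cryptography/LWE.lean`: `lweSample χ s` = `A_{s,χ}` over a finite
commutative ring `R`, index `Fin k`; Ring-LWE is `k = 1`, Module-LWE of rank `k` is `R = 𝓞_K/q`).

Lyubashevsky–Peikert–Regev, *On ideal lattices and learning with errors over rings*, J. ACM 60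
(2013), §2.4.1 (p. 17): "The number field `K` has `n = φ(m)` automorphisms `τ_k : K → K` indexed
by `k ∈ ℤ_m^*`, which are defined as `τ_k(ζ) = ζ^k`"; Lemma 2.16: "for any `i, j ∈ ℤ_m^*` we have
`τ_j(𝔮_i) = 𝔮_{i/j}`" (the automorphisms act transitively on the primes above `q`; for the general
statement use Mathlib's `Ideal.exists_smul_eq_of_isGaloisGroup`). §5.1, proof of Lemma 5.5 (LWE to
`𝔮_i`-LWE), p. 27, verbatim: "transform each sample `(a, b) ← A_{s,ψ}` into the sample
`(τ_k(a), τ_k(b))` … because `b = as/q + e` and `τ_k(q) = q`, we have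
`τ_k(b) = τ_k(a)·τ_k(s)/q + τ_k(e)`. Because `τ_k` is an automorphism on `R`, `τ_k(a)` is uniformly
random in `τ_k(R_q) = R_q`, and the pairs `(τ_k(a), τ_k(b))` are distributed according to
`A_{τ_k(s),ψ'}` where `ψ' = τ_k(ψ)`." Lemma 5.6 (p. 27): "For any `α > 0`, the family `Ψ_{≤α}` is
closed under every automorphism `τ` of `K`", proof: "`τ_j(D_r) = D_{r'}` where the entries of `r'`
are merely a rearrangement of the entries of `r` … for any `x ∈ K` the coordinates of `σ(x)` and
`σ(τ_j(x))` are merely a rearrangement of each other." P. 26: "any fixed spherical Gaussian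
distribution `D_α` is invariant under all the automorphisms; therefore, if one assumes that the
search problem `LWE_{q,D_α}` is hard …, then one can simplify our chain of reductions to use error
distribution `D_α` in all the average-case problems" (Theorem 5.3).

RECORDED HERE, as exact identities of distributions in the discrete `LWE.lean` vocabulary:

* `LWE.autSample τ` / `LWE.autSamples τ m` — the transformation `(a, b) ↦ (τ∘a, τ b)` for a ring
  automorphism `τ : R ≃+* R` (coordinatewise on `a ∈ R^k`), on one / on `m` samples;
* `LWE.lweSample_map_autSample` — Lemma 5.5's identity `τ_*(A_{s,χ}) = A_{τ∘s, τ_*χ}` (a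
  specialisation of the tree's `lweSample_map_ringHom`); `uniformPair_map_autSample` (`U ↦ U`);
  `m`-sample versions; `normalFormSamples_map_autSamples` — the normal-form experiment
  (secret `← χ^k`, then `A_{s,χ}^m`) is transported to the one with law `τ_*χ`;
* `LWE.acceptProb_comp` and `LWE.distinguishingGap_comp_of_invariant` — a distinguisher composed
  with `τ` has the same acceptance gap whenever both branches are `τ`-invariant; with
  `τ_*χ = χ` ("`D_α` is invariant under all the automorphisms") every LWE-type experiment above is
  `τ`-invariant (`…_of_invariant` corollaries);
* the discrete analogue of Lemma 5.6 for COEFFICIENT laws: `LWE.signedPerm π ε` (a signed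
  permutation of integer coordinate vectors) and `LWE.iidPMF_map_signedPerm` — an iid product of a
  SYMMETRIC law `μ` on `ℤ` (`μ(−z) = μ(z)`: centred binomial, centred discrete Gaussian, uniform on
  `[−η, η]`) is invariant under every signed permutation ("merely a rearrangement"); hence
  (`LWE.coeffLaw_map_eq_of_signedPerm`) a coefficient law `(μ^{⊗n}) ∘ ofCoords⁻¹` on `R` is
  invariant under any `τ` that acts on coordinates by a signed permutation — the case of the
  automorphisms `ζ ↦ ζ^k` of the power-of-two cyclotomic rings `ℤ_q[x]/(x^n + 1)` in the power
  basis (`ζ^j ↦ ζ^{jk} = ±ζ^{jk mod n}` since `ζ^n = −1`), verified for the concrete rings on the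
  Summits side.

Consequence used by the PQC-structure cell (automorphism-orbit tests): for ML-KEM / ML-DSA /
Falcon-type coefficient laws the whole (normal-form) MLWE experiment is EXACTLY invariant under
`(A, b, s) ↦ (τA, τb, τs)`, so any test statistic has the same law on an instance and on its
Galois conjugates, and evaluation-type attacks at `ζ` and at `ζ^k` have identical success
probabilities (LPR13's "shuffling" of the `𝔮_i`).

## References

* V. Lyubashevsky, C. Peikert, O. Regev, *On ideal lattices and learning with errors over rings*,
  J. ACM 60 (2013) art. 43: §2.4.1, Lemma 2.16; §5 (p. 26, Thm. 5.3); §5.1 Lemma 5.5 (proof),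
  Lemma 5.6 (proof). [LyubashevskyPeikertRegev2013JACM]
* Y. Elias, K. E. Lauter, E. Ozman, K. E. Stange, *Provably weak instances of Ring-LWE*, CRYPTO
  2015 (the homomorphic-image identity `lweSample_map_ringHom` reused here). [EliasEtAl2015]
-/

noncomputable section

open scoped ENNReal

namespace Literature.Computability.Cryptography

namespace LWE

/-! ### The transformation `(a, b) ↦ (τ a, τ b)` -/

section Aut

variable {R : Type} [CommRing R] {k : ℕ}

/-- LPR13's transformation of one sample by a ring automorphism `τ`: `(a, b) ↦ (τ∘a, τ b)`
(coordinatewise on `a ∈ R^k`; printed for `k = 1`). [cite: LyubashevskyPeikertRegev2013JACM, Lemma 5.5 (proof: "transform each sample (a, b) into (τ_k(a), τ_k(b))")] -/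
def autSample (τ : R ≃+* R) (p : (Fin k → R) × R) : (Fin k → R) × R :=
  (τ ∘ p.1, τ p.2)

/-- The same transformation applied to each of `m` samples. [cite: LyubashevskyPeikertRegev2013JACM, Lemma 5.5 (proof)] -/
def autSamples (τ : R ≃+* R) (m : ℕ) (v : Fin m → (Fin k → R) × R) : Fin m → (Fin k → R) × R :=
  fun i ↦ autSample τ (v i)

/-- Unfolding lemma. [cite: LyubashevskyPeikertRegev2013JACM, Lemma 5.5 (proof)] -/
@[simp] theorem autSample_apply (τ : R ≃+* R) (a : Fin k → R) (b : R) :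
    autSample τ (a, b) = (τ ∘ a, τ b) := rfl

/-- `autSamples τ m` is post-composition with `autSample τ`. [cite: LyubashevskyPeikertRegev2013JACM, Lemma 5.5 (proof)] -/
theorem autSamples_eq_comp (τ : R ≃+* R) (m : ℕ) :
    autSamples (k := k) τ m = fun v ↦ autSample τ ∘ v := rfl

/-- The secret is transported too: `(τ∘·)_*(ν^{⊗k}) = (τ_*ν)^{⊗k}` for an iid secret law (normal form:
`ν = χ`). [cite: LyubashevskyPeikertRegev2013JACM, Lemma 5.5 (proof: "A_{τ_k(s),ψ'}")] -/
theorem iidPMF_map_comp_ringEquiv (τ : R ≃+* R) (ν : PMF R) (k : ℕ) :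
    (iidPMF ν k).map (fun s : Fin k → R ↦ τ ∘ s) = iidPMF (ν.map τ) k :=
  iidPMF_map ν τ k

variable [Fintype R]

/-- **Lemma 5.5's identity**: `τ_*(A_{s,χ}) = A_{τ∘s, τ_*χ}` — "the pairs `(τ_k(a), τ_k(b))` are
distributed according to `A_{τ_k(s),ψ'}` where `ψ' = τ_k(ψ)`" (discrete form, any finite commutative
ring, any rank `k`). [cite: LyubashevskyPeikertRegev2013JACM, Lemma 5.5 (proof, p. 27)] -/
theorem lweSample_map_autSample (τ : R ≃+* R) (χ : PMF R) (s : Fin k → R) :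
    (lweSample χ s).map (autSample τ) = lweSample (χ.map τ) (τ ∘ s) :=
  lweSample_map_ringHom τ.toRingHom τ.surjective χ s

/-- Uniform pairs stay uniform: `τ_*(U(R^k × R)) = U(R^k × R)` ("`τ_k(a)` is uniformly random in
`τ_k(R_q) = R_q`"). [cite: LyubashevskyPeikertRegev2013JACM, Lemma 5.5 (proof, p. 27)] -/
theorem uniformPair_map_autSample (τ : R ≃+* R) :
    (PMF.uniformOfFintype ((Fin k → R) × R)).map (autSample τ) =
      PMF.uniformOfFintype ((Fin k → R) × R) :=
  uniformPair_map_ringHom τ.toRingHom τ.surjective k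

/-- `m` samples: `τ_*(A_{s,χ}^m) = A_{τ∘s, τ_*χ}^m`. [cite: LyubashevskyPeikertRegev2013JACM, Lemma 5.5 (proof: "transform each sample")] -/
theorem lweSamples_map_autSamples (τ : R ≃+* R) (χ : PMF R) (s : Fin k → R) (m : ℕ) :
    (lweSamples χ s m).map (autSamples τ m) = lweSamples (χ.map τ) (τ ∘ s) m := by
  rw [autSamples_eq_comp, lweSamples, lweSamples, iidPMF_map, lweSample_map_autSample]

/-- `m` uniform samples stay uniform. [cite: LyubashevskyPeikertRegev2013JACM, Lemma 5.5 (proof, p. 27)] -/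
theorem uniformSamples_map_autSamples (τ : R ≃+* R) (m : ℕ) :
    (uniformSamples (Fin k) R m).map (autSamples τ m) = uniformSamples (Fin k) R m := by
  rw [autSamples_eq_comp, uniformSamples_eq_iidPMF_holds, iidPMF_map, uniformPair_map_autSample]

/-- A uniform secret stays uniform: `(τ∘·)_*(U(R^k)) = U(R^k)`. [cite: LyubashevskyPeikertRegev2013JACM, Lemma 5.5 (proof, p. 27)] -/
theorem uniformSecret_map_comp_ringEquiv (τ : R ≃+* R) (k : ℕ) :
    (PMF.uniformOfFintype (Fin k → R)).map (fun s : Fin k → R ↦ τ ∘ s) =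
      PMF.uniformOfFintype (Fin k → R) :=
  uniform_pi_map_ringHom τ.toRingHom τ.surjective k

/-- **The normal-form experiment is transported as a whole**: with secret `s ← χ^k` and samples
`A_{s,χ}^m`, applying `τ` samplewise yields EXACTLY the normal-form experiment for the law `τ_*χ`
(the secret `τ∘s` having law `(τ_*χ)^k`). [cite: LyubashevskyPeikertRegev2013JACM, Lemma 5.5 (proof) and p. 26 (Theorem 5.3 discussion)] -/
theorem normalFormSamples_map_autSamples (τ : R ≃+* R) (χ : PMF R) (k m : ℕ) :
    ((iidPMF χ k).bind fun s ↦ lweSamples χ s m).map (autSamples τ m) =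
      (iidPMF (χ.map τ) k).bind fun s ↦ lweSamples (χ.map τ) s m := by
  rw [PMF.map_bind]
  simp_rw [lweSamples_map_autSamples]
  conv_rhs => rw [← iidPMF_map_comp_ringEquiv τ χ k, PMF.bind_map]
  rfl

/-- The uniform-secret experiment is transported: `τ_*(s ← U; A_{s,χ}^m) = (s ← U; A_{s,τ_*χ}^m)`. [cite: LyubashevskyPeikertRegev2013JACM, Lemma 5.5 (proof) and p. 26] -/
theorem lweSamplesUniformSecret_map_autSamples (τ : R ≃+* R) (χ : PMF R) (m : ℕ) :
    (lweSamplesUniformSecret (ι := Fin k) χ m).map (autSamples τ m) =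
      lweSamplesUniformSecret (ι := Fin k) (χ.map τ) m := by
  rw [lweSamplesUniformSecret, lweSamplesUniformSecret, PMF.map_bind]
  simp_rw [lweSamples_map_autSamples]
  conv_rhs => rw [← uniformSecret_map_comp_ringEquiv τ k, PMF.bind_map]
  rfl

/-! #### Invariant error laws ("`D_α` is invariant under all the automorphisms") -/

/-- With a `τ`-invariant error law, `τ_*(A_{s,χ}) = A_{τ∘s,χ}`. [cite: LyubashevskyPeikertRegev2013JACM, §5 p. 26 ("any fixed spherical Gaussian distribution D_α is invariant under all the automorphisms") and Theorem 5.3] -/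
theorem lweSample_map_autSample_of_invariant {τ : R ≃+* R} {χ : PMF R} (hχ : χ.map τ = χ)
    (s : Fin k → R) : (lweSample χ s).map (autSample τ) = lweSample χ (τ ∘ s) := by
  rw [lweSample_map_autSample, hχ]

/-- With a `τ`-invariant error law the normal-form experiment is `τ`-INVARIANT. [cite: LyubashevskyPeikertRegev2013JACM, §5 p. 26 and Theorem 5.3] -/
theorem normalFormSamples_map_autSamples_of_invariant {τ : R ≃+* R} {χ : PMF R}
    (hχ : χ.map τ = χ) (k m : ℕ) :
    ((iidPMF χ k).bind fun s ↦ lweSamples χ s m).map (autSamples τ m) =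
      (iidPMF χ k).bind fun s ↦ lweSamples χ s m := by
  rw [normalFormSamples_map_autSamples, hχ]

/-- With a `τ`-invariant error law the uniform-secret experiment is `τ`-invariant. [cite: LyubashevskyPeikertRegev2013JACM, §5 p. 26 and Theorem 5.3] -/
theorem lweSamplesUniformSecret_map_autSamples_of_invariant {τ : R ≃+* R} {χ : PMF R}
    (hχ : χ.map τ = χ) (m : ℕ) :
    (lweSamplesUniformSecret (ι := Fin k) χ m).map (autSamples τ m) =
      lweSamplesUniformSecret (ι := Fin k) χ m := by
  rw [lweSamplesUniformSecret_map_autSamples, hχ]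

/-! #### Distinguishers composed with `τ` -/

/-- Running `D` on transformed inputs = running `D` on the push-forward law:
`Pr[D(T x) accepts, x ← P] = Pr[D(y) accepts, y ← T_*P]`. [cite: LyubashevskyPeikertRegev2013JACM, Lemma 5.5 (proof: "Give the transformed samples to the … oracle")] -/
theorem acceptProb_comp {β γ : Type} (D : γ → PMF Bool) (T : β → γ) (P : PMF β) :
    acceptProb (fun x ↦ D (T x)) P = acceptProb D (P.map T) := by
  rw [acceptProb, acceptProb, PMF.bind_map]
  rfl

/-- If both branches `P`, `Q` of a decision experiment are `T`-invariant, composing the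
distinguisher with `T` does not change its acceptance gap. [cite: LyubashevskyPeikertRegev2013JACM, §5 p. 26 (invariant error distribution ⇒ same average-case problems)] -/
theorem distinguishingGap_comp_of_invariant {β : Type} (D : β → PMF Bool) {T : β → β} {P Q : PMF β}
    (hP : P.map T = P) (hQ : Q.map T = Q) :
    |(acceptProb (fun x ↦ D (T x)) P).toReal - (acceptProb (fun x ↦ D (T x)) Q).toReal| =
      |(acceptProb D P).toReal - (acceptProb D Q).toReal| := by
  rw [acceptProb_comp D T P, acceptProb_comp D T Q, hP, hQ]

/-- In particular the (uniform-secret) decision-LWE advantage of `D ∘ τ` equals that of `D` for a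
`τ`-invariant error law. [cite: LyubashevskyPeikertRegev2013JACM, §5 p. 26 and Theorem 5.3] -/
theorem distinguishingAdvantage_comp_autSamples {τ : R ≃+* R} {χ : PMF R} (hχ : χ.map τ = χ)
    (m : ℕ) (D : Distinguisher (Fin k) R m) :
    distinguishingAdvantage χ m (fun v ↦ D (autSamples τ m v)) = distinguishingAdvantage χ m D :=
  distinguishingGap_comp_of_invariant D (lweSamplesUniformSecret_map_autSamples_of_invariant hχ m)
    (uniformSamples_map_autSamples τ m)

/-- … and the normal-form (secret `← χ^k`) advantage of `D ∘ τ` equals that of `D`. [cite: LyubashevskyPeikertRegev2013JACM, §5 p. 26 and Theorem 5.3] -/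
theorem normalFormGap_comp_autSamples {τ : R ≃+* R} {χ : PMF R} (hχ : χ.map τ = χ) (m : ℕ)
    (D : Distinguisher (Fin k) R m) :
    |(acceptProb (fun v ↦ D (autSamples τ m v)) ((iidPMF χ k).bind fun s ↦ lweSamples χ s m)).toReal -
        (acceptProb (fun v ↦ D (autSamples τ m v)) (uniformSamples (Fin k) R m)).toReal| =
      |(acceptProb D ((iidPMF χ k).bind fun s ↦ lweSamples χ s m)).toReal -
        (acceptProb D (uniformSamples (Fin k) R m)).toReal| :=
  distinguishingGap_comp_of_invariant D (normalFormSamples_map_autSamples_of_invariant hχ k m)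
    (uniformSamples_map_autSamples τ m)

end Aut

/-! ### Signed permutations of integer coordinates and symmetric product laws (Lemma 5.6, discrete) -/

section SignedPerm

variable {n : ℕ}

/-- A signed permutation of integer coordinate vectors: `(F v)_i = ε_i · v_{π(i)}` with `ε_i = ±1`
(the shape of the action of `ζ ↦ ζ^k` on the power basis of `ℤ[x]/(xⁿ + 1)`: `ζ^j ↦ ±ζ^{jk mod n}`;
LPR13: "merely a rearrangement"). [cite: LyubashevskyPeikertRegev2013JACM, Lemma 5.6 (proof: coordinates "merely a rearrangement of each other")] -/
def signedPerm (π : Equiv.Perm (Fin n)) (ε : Fin n → ℤˣ) (v : Fin n → ℤ) : Fin n → ℤ :=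
  fun i ↦ (ε i : ℤ) * v (π i)

/-- Unfolding lemma. [cite: LyubashevskyPeikertRegev2013JACM, Lemma 5.6 (proof)] -/
@[simp] theorem signedPerm_apply (π : Equiv.Perm (Fin n)) (ε : Fin n → ℤˣ) (v : Fin n → ℤ)
    (i : Fin n) : signedPerm π ε v i = (ε i : ℤ) * v (π i) := rfl

/-- The inverse signed permutation `(G w)_j = ε_{π⁻¹ j}⁻¹ · w_{π⁻¹ j}`. [cite: LyubashevskyPeikertRegev2013JACM, Lemma 5.6 (proof)] -/
def signedPermInv (π : Equiv.Perm (Fin n)) (ε : Fin n → ℤˣ) (w : Fin n → ℤ) : Fin n → ℤ :=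
  fun j ↦ ((ε (π.symm j))⁻¹ : ℤˣ) * w (π.symm j)

/-- `signedPermInv` is a left inverse. [cite: LyubashevskyPeikertRegev2013JACM, Lemma 5.6 (proof)] -/
theorem signedPermInv_signedPerm (π : Equiv.Perm (Fin n)) (ε : Fin n → ℤˣ) (v : Fin n → ℤ) :
    signedPermInv π ε (signedPerm π ε v) = v := by
  funext j
  simp only [signedPermInv, signedPerm_apply, Equiv.apply_symm_apply, ← mul_assoc,
    Units.inv_mul, one_mul]

/-- `signedPermInv` is a right inverse. [cite: LyubashevskyPeikertRegev2013JACM, Lemma 5.6 (proof)] -/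
theorem signedPerm_signedPermInv (π : Equiv.Perm (Fin n)) (ε : Fin n → ℤˣ) (w : Fin n → ℤ) :
    signedPerm π ε (signedPermInv π ε w) = w := by
  funext i
  simp only [signedPerm_apply, signedPermInv, Equiv.symm_apply_apply, ← mul_assoc,
    Units.mul_inv, one_mul]

/-- A signed permutation is a bijection of `ℤⁿ`. [cite: LyubashevskyPeikertRegev2013JACM, Lemma 5.6 (proof)] -/
theorem signedPerm_bijective (π : Equiv.Perm (Fin n)) (ε : Fin n → ℤˣ) :
    Function.Bijective (signedPerm π ε) :=
  Function.bijective_iff_has_inverse.2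
    ⟨signedPermInv π ε, signedPermInv_signedPerm π ε, signedPerm_signedPermInv π ε⟩

/-- A symmetric law gives the same mass to `u·z` and `z` for a unit `u = ±1` of `ℤ`. [cite: LyubashevskyPeikertRegev2013JACM, Lemma 5.6 (proof)] -/
theorem apply_units_mul_of_symmetric {μ : PMF ℤ} (hμ : ∀ z, μ (-z) = μ z) (u : ℤˣ) (z : ℤ) :
    μ ((u : ℤ) * z) = μ z := by
  rcases Int.units_eq_one_or u with rfl | rfl
  · rw [Units.val_one, one_mul]
  · rw [Units.val_neg, Units.val_one, neg_one_mul, hμ]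

/-- **Lemma 5.6, discrete coefficient form**: an iid product of a SYMMETRIC law on `ℤ` is invariant
under every signed permutation of the coordinates (`μ^{⊗n} ∘ F⁻¹ = μ^{⊗n}`: the factors of
`∏ μ(v_i)` are "merely a rearrangement of each other", signs absorbed by symmetry). [cite: LyubashevskyPeikertRegev2013JACM, Lemma 5.6 (proof)] -/
theorem iidPMF_map_signedPerm {μ : PMF ℤ} (hμ : ∀ z, μ (-z) = μ z) (π : Equiv.Perm (Fin n))
    (ε : Fin n → ℤˣ) : (iidPMF μ n).map (signedPerm π ε) = iidPMF μ n := by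
  ext w
  rw [← signedPerm_signedPermInv π ε w,
    pmf_map_apply_of_injective _ (signedPerm_bijective π ε).injective, signedPerm_signedPermInv,
    iidPMF_apply_holds, iidPMF_apply_holds]
  simp only [signedPermInv, apply_units_mul_of_symmetric hμ]
  exact Equiv.prod_comp π.symm (fun j ↦ μ (w j))

/-- **Coefficient laws are invariant under automorphisms acting as signed permutations**: if
`τ : R → R` acts on coordinate vectors (through any coordinate map `ofCoords : ℤⁿ → R`, e.g. the
power basis of `ℤ_q[x]/(xⁿ+1)`) by a signed permutation, `τ (ofCoords v) = ofCoords (F v)`, then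
the law on `R` of an element with iid symmetric coordinates is `τ`-invariant. [cite: LyubashevskyPeikertRegev2013JACM, Lemma 5.6 and §5 p. 26 ("D_α is invariant under all the automorphisms")] -/
theorem coeffLaw_map_eq_of_signedPerm {R : Type} {μ : PMF ℤ} (hμ : ∀ z, μ (-z) = μ z)
    (ofCoords : (Fin n → ℤ) → R) {τ : R → R} {π : Equiv.Perm (Fin n)} {ε : Fin n → ℤˣ}
    (hτ : ∀ v, τ (ofCoords v) = ofCoords (signedPerm π ε v)) :
    ((iidPMF μ n).map ofCoords).map τ = (iidPMF μ n).map ofCoords := by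
  rw [PMF.map_comp, show τ ∘ ofCoords = ofCoords ∘ signedPerm π ε from funext hτ, ← PMF.map_comp,
    iidPMF_map_signedPerm hμ]

end SignedPerm

end LWE

end Literature.Computability.Cryptography

end
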